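import Summits.HubbardSuperconductivity.HubbardSuperconductivity.Theorems.AnisotropyChordAmplitudeStableHolds
import Summits.HubbardSuperconductivity.HubbardSuperconductivity.Theorems.AnisotropyChordEnergyConvexAllGraphs
import Literature.Algebra.Polynomial.NewtonInequalities
import Literature.Algebra.Polynomial.HermiteRealRootedness

/-!
# Route `AnisotropyChord`: THEOREM E-CONV IS UNCONDITIONAL — heat-amplitude log-concavity, hence
# convexity of the XXZ sector energies along the magnetisation ladder, on every finite graph, `|Δ| ≤ 1`

We PROVE the theory seat's finite-imaginary-time statement `XXZSectorHeatAmplitudeLogConcave`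
(`…EnergyConvexityDefs`; memo ROTOR-THEORY-6 §67): for `Δ ∈ [−1,1]`, `t ≥ 0` and `1 ≤ W ≤ |V| − 1` the
heat amplitudes `c_k(t) = Re⟨𝟙_k, e^{−tH} 𝟙_k⟩` (`𝟙_k` = indicator of the weight-`k` configurations,
`H = xxzHamiltonian 1 G (−1) Δ`) satisfy `c_{W−1} c_{W+1} ≤ c_W²`; with `…EnergyConvexAllGraphs`
(`xxzSectorEnergyConvex_of_logConcave`) this gives **E-CONV as a tree theorem**:
`xxzSectorEnergyConvex_holds : XXZSectorEnergyConvex` — `2E(M) ≤ E(M−1) + E(M+1)` for the lowest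
sector energies of `H(Δ)`, every finite graph, every `Δ ∈ [−1,1]` (positive inverse compressibility of
hard-core lattice bosons / no magnetisation jump of easy-plane magnets, memo §67, §73, §77).

Proof (the theory seat's §67 argument, assembled from tree theorems).  The product vector
`Φ_y(σ) = y^{#{σ = 1}}` has occupation polynomial `Π_x (z_x + y)`, zero-free on `ℍ^V` for `Im y ≥ 0`;
by S2 (`xxz_gibbs_preserves_occStable` — Borcea–Brändén + Lie–Trotter + Hurwitz, BEC line) so is
`e^{−tH} Φ_y`.  Since `e^{−tH}` preserves weight sectors (`stub_gibbsStructure`),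
`(e^{−tH}Φ_y)(1⁰_S) = y^{n−|S|} (e^{−tH} 𝟙_{n−|S|})(1⁰_S)`, so
`Q(y, z) = Σ_S (e^{−tH}𝟙_{n−|S|})(1⁰_S) · y^{n−|S|} · Π_{i∈S} (z_i + 1)` is an upper-half-plane stable
polynomial in the `1 + |V|` variables `(y, z)`; setting the `z`-block to `0`
(`IsUpperHalfPlaneStable.eq_zero_or_setInrZero`, Hurwitz) leaves `q(y) = Σ_k c_k(t) y^k`, zero-free on
`ℍ`, with real coefficients and `c_0 > 0` — hence REAL-ROOTED (`splits_of_forall_mem_aroots_im_eq_zero`),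
and Newton's inequalities (`coeff_mul_coeff_le_sq`, Bóna Thm 1.32) give `c_{W−1} c_{W+1} ≤ c_W²`.
Theory seat `hubbard-h0-rotor-theory-1`.  No definition is introduced.
-/

set_option linter.dupNamespace false

noncomputable section

namespace Summit.HubbardSuperconductivity.HubbardSuperconductivity.Theorems.AnisotropyChord

open Matrix Complex Finset Filter Topology
open scoped ComplexOrder ComplexConjugate
open Literature.MathematicalPhysics.QuantumLattice Literature.Probability.LatticeModels
open Literature.Combinatorics.StablePolynomials (IsUpperHalfPlaneStable setInrZero eval_setInrZero)
open Summit.AtomisticToContinuum.BoseEinsteinCondensation.Cruxes.GroundStateStability.StableConeVariationalSelection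
  (stub_gibbsStructure coneSel_indicator_filter_eq coneSel_indicator_eq_iff)

section Helpers

variable {V : Type} [Fintype V] [DecidableEq V]

/-- **Structure of `e^{−tH(Δ)}`, `t ≥ 0`** (from the BEC line's `stub_gibbsStructure`, plus `t = 0`):
it maps entrywise real non-negative vectors to such vectors and preserves every magnetisation sector.
[folklore] -/
theorem gibbs_structure (G : SimpleGraph V) [DecidableRel G.Adj] (Δ : ℝ) {t : ℝ} (ht : 0 ≤ t) :
    (∀ φ : TensorIndex V 2 → ℂ, (∀ σ, 0 ≤ (φ σ).re ∧ (φ σ).im = 0) →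
      ∀ σ, 0 ≤ ((NormedSpace.exp (-(t : ℂ) • xxzHamiltonian 1 G (-1) Δ) *ᵥ φ) σ).re ∧
        ((NormedSpace.exp (-(t : ℂ) • xxzHamiltonian 1 G (-1) Δ) *ᵥ φ) σ).im = 0) ∧
    (∀ (M : ℝ) (φ : TensorIndex V 2 → ℂ), φ ∈ spinZSector (Λ := V) 1 M →
      NormedSpace.exp (-(t : ℂ) • xxzHamiltonian 1 G (-1) Δ) *ᵥ φ ∈ spinZSector (Λ := V) 1 M) := by
  rcases ht.eq_or_lt with h0 | hpos
  · have h1 : NormedSpace.exp (-((t : ℝ) : ℂ) • xxzHamiltonian 1 G (-1) Δ) = 1 := by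
      rw [← h0, Complex.ofReal_zero, neg_zero, zero_smul, NormedSpace.exp_zero]
    refine ⟨fun φ hφ σ => ?_, fun M φ hφ => ?_⟩
    · rw [h1, Matrix.one_mulVec]; exact hφ σ
    · rw [h1, Matrix.one_mulVec]; exact hφ
  · have h := stub_gibbsStructure V G Δ (fun _ => (0 : ℝ)) t hpos
    simp only [Complex.ofReal_zero, zero_smul, Finset.sum_const_zero, add_zero, Matrix.gibbsWeight] at h
    exact ⟨h.2.1, h.2.2⟩

/-- The weight-`k` indicator lies in the weight-`k` sector. [folklore] -/
theorem ind_mem_weightSector (k : ℕ) :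
    (fun σ : V → Fin 2 => if (Finset.univ.filter fun x => σ x = 1).card = k then (1 : ℂ) else 0) ∈
      spinZSector (Λ := V) 1 (((Fintype.card V * 1 : ℕ) : ℝ) / 2 - k) := by
  rw [LiebMattis.mem_spinZSector_weight_iff]
  intro σ hσ
  rw [weight_eq_card_filter] at hσ
  simp only [if_neg hσ]

/-- `e^{−tH} 𝟙_k` vanishes off the weight-`k` configurations. [folklore] -/
theorem gibbs_ind_apply_eq_zero (G : SimpleGraph V) [DecidableRel G.Adj] (Δ : ℝ) {t : ℝ} (ht : 0 ≤ t)
    {k : ℕ} {σ : V → Fin 2} (hσ : (Finset.univ.filter fun x => σ x = 1).card ≠ k) :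
    (NormedSpace.exp (-(t : ℂ) • xxzHamiltonian 1 G (-1) Δ) *ᵥ
      (fun τ : V → Fin 2 => if (Finset.univ.filter fun x => τ x = 1).card = k then (1 : ℂ) else 0)) σ = 0 := by
  have hmem := (gibbs_structure G Δ ht).2 _ _ (ind_mem_weightSector (V := V) k)
  rw [LiebMattis.mem_spinZSector_weight_iff] at hmem
  exact hmem σ (by rwa [weight_eq_card_filter])

/-- `e^{−tH} 𝟙_k` is entrywise real. [folklore] -/
theorem gibbs_ind_im_eq_zero (G : SimpleGraph V) [DecidableRel G.Adj] (Δ : ℝ) {t : ℝ} (ht : 0 ≤ t)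
    (k : ℕ) (σ : V → Fin 2) :
    ((NormedSpace.exp (-(t : ℂ) • xxzHamiltonian 1 G (-1) Δ) *ᵥ
      (fun τ : V → Fin 2 => if (Finset.univ.filter fun x => τ x = 1).card = k then (1 : ℂ) else 0)) σ).im
      = 0 :=
  ((gibbs_structure G Δ ht).1 _ (fun τ => by
    by_cases h : (Finset.univ.filter fun x => τ x = 1).card = k
    · simp [if_pos h]
    · simp [if_neg h]) σ).2

/-- **The heat coefficient as a plain sum:** `⟨𝟙_k, e^{−tH} 𝟙_k⟩ = Σ_σ (e^{−tH} 𝟙_k)(σ)` (the evolved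
indicator vanishes off weight `k`). [folklore] -/
theorem heatCoeff_eq_sum (G : SimpleGraph V) [DecidableRel G.Adj] (Δ : ℝ) {t : ℝ} (ht : 0 ≤ t) (k : ℕ) :
    star (fun τ : V → Fin 2 => if (Finset.univ.filter fun x => τ x = 1).card = k then (1 : ℂ) else 0) ⬝ᵥ
        NormedSpace.exp (-(t : ℂ) • xxzHamiltonian 1 G (-1) Δ) *ᵥ
          (fun τ : V → Fin 2 => if (Finset.univ.filter fun x => τ x = 1).card = k then (1 : ℂ) else 0) =
      ∑ σ : V → Fin 2, (NormedSpace.exp (-(t : ℂ) • xxzHamiltonian 1 G (-1) Δ) *ᵥ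
          (fun τ : V → Fin 2 => if (Finset.univ.filter fun x => τ x = 1).card = k then (1 : ℂ) else 0)) σ := by
  rw [dotProduct]
  refine Finset.sum_congr rfl fun σ _ => ?_
  rw [Pi.star_apply]
  by_cases h : (Finset.univ.filter fun x => σ x = 1).card = k
  · rw [if_pos h, star_one, one_mul]
  · rw [if_neg h, star_zero, zero_mul, gibbs_ind_apply_eq_zero G Δ ht h]

/-- **The heat coefficient is real:** `⟨𝟙_k, e^{−tH} 𝟙_k⟩ = Re⟨𝟙_k, e^{−tH} 𝟙_k⟩`. [folklore] -/
theorem heatCoeff_eq_ofReal (G : SimpleGraph V) [DecidableRel G.Adj] (Δ : ℝ) {t : ℝ} (ht : 0 ≤ t) (k : ℕ) :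
    star (fun τ : V → Fin 2 => if (Finset.univ.filter fun x => τ x = 1).card = k then (1 : ℂ) else 0) ⬝ᵥ
        NormedSpace.exp (-(t : ℂ) • xxzHamiltonian 1 G (-1) Δ) *ᵥ
          (fun τ : V → Fin 2 => if (Finset.univ.filter fun x => τ x = 1).card = k then (1 : ℂ) else 0) =
      (((star (fun τ : V → Fin 2 => if (Finset.univ.filter fun x => τ x = 1).card = k then (1 : ℂ) else 0) ⬝ᵥ
        NormedSpace.exp (-(t : ℂ) • xxzHamiltonian 1 G (-1) Δ) *ᵥ
          (fun τ : V → Fin 2 => if (Finset.univ.filter fun x => τ x = 1).card = k then (1 : ℂ) else 0)).re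
        : ℝ) : ℂ) := by
  apply Complex.ext
  · rw [Complex.ofReal_re]
  · rw [Complex.ofReal_im, heatCoeff_eq_sum G Δ ht k, Complex.im_sum]
    exact Finset.sum_eq_zero fun σ _ => gibbs_ind_im_eq_zero G Δ ht k σ

/-- **Sector decomposition of the evolved product state:**
`(e^{−tH} Φ_y)(σ) = y^{w(σ)} (e^{−tH} 𝟙_{w(σ)})(σ)`, `Φ_y(τ) = y^{w(τ)}`, `w` = number of sites with
value `1`. [folklore] -/
theorem gibbs_productState_apply (G : SimpleGraph V) [DecidableRel G.Adj] (Δ : ℝ) {t : ℝ} (ht : 0 ≤ t)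
    (y : ℂ) (σ : V → Fin 2) :
    (NormedSpace.exp (-(t : ℂ) • xxzHamiltonian 1 G (-1) Δ) *ᵥ
        (fun τ : V → Fin 2 => y ^ (Finset.univ.filter fun x => τ x = 1).card)) σ =
      y ^ (Finset.univ.filter fun x => σ x = 1).card *
        (NormedSpace.exp (-(t : ℂ) • xxzHamiltonian 1 G (-1) Δ) *ᵥ
          (fun τ : V → Fin 2 => if (Finset.univ.filter fun x => τ x = 1).card =
            (Finset.univ.filter fun x => σ x = 1).card then (1 : ℂ) else 0)) σ := by
  have hΦ : (fun τ : V → Fin 2 => y ^ (Finset.univ.filter fun x => τ x = 1).card) =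
      ∑ k ∈ Finset.range (Fintype.card V + 1),
        (y ^ k) • (fun τ : V → Fin 2 =>
          if (Finset.univ.filter fun x => τ x = 1).card = k then (1 : ℂ) else 0) := by
    funext τ
    rw [Finset.sum_apply]
    simp only [Pi.smul_apply, smul_eq_mul, mul_ite, mul_one, mul_zero]
    rw [Finset.sum_ite_eq, if_pos]
    exact Finset.mem_range.mpr (Nat.lt_succ_of_le
      ((Finset.card_filter_le _ _).trans (Finset.card_univ (α := V)).le))
  rw [hΦ, Matrix.mulVec_sum, Finset.sum_apply]
  simp only [Matrix.mulVec_smul, Pi.smul_apply, smul_eq_mul]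
  rw [Finset.sum_eq_single ((Finset.univ.filter fun x => σ x = 1).card)]
  · intro k _ hk
    rw [gibbs_ind_apply_eq_zero G Δ ht (Ne.symm hk), mul_zero]
  · intro h
    exact absurd (Finset.mem_range.mpr (Nat.lt_succ_of_le
      ((Finset.card_filter_le _ _).trans (Finset.card_univ (α := V)).le))) h

/-- **Generating function of the heat coefficients:**
`Σ_σ (e^{−tH} Φ_y)(σ) = Σ_{k ≤ n} ⟨𝟙_k, e^{−tH} 𝟙_k⟩ y^k`. [folklore] -/
theorem sum_gibbs_productState (G : SimpleGraph V) [DecidableRel G.Adj] (Δ : ℝ) {t : ℝ} (ht : 0 ≤ t)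
    (y : ℂ) :
    (∑ σ : V → Fin 2, (NormedSpace.exp (-(t : ℂ) • xxzHamiltonian 1 G (-1) Δ) *ᵥ
        (fun τ : V → Fin 2 => y ^ (Finset.univ.filter fun x => τ x = 1).card)) σ) =
      ∑ k ∈ Finset.range (Fintype.card V + 1),
        (star (fun τ : V → Fin 2 => if (Finset.univ.filter fun x => τ x = 1).card = k then (1 : ℂ) else 0) ⬝ᵥ
          NormedSpace.exp (-(t : ℂ) • xxzHamiltonian 1 G (-1) Δ) *ᵥ
            (fun τ : V → Fin 2 => if (Finset.univ.filter fun x => τ x = 1).card = k then (1 : ℂ) else 0)) *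
          y ^ k := by
  simp_rw [heatCoeff_eq_sum G Δ ht, Finset.sum_mul]
  rw [Finset.sum_comm]
  refine Finset.sum_congr rfl fun σ _ => ?_
  rw [gibbs_productState_apply G Δ ht y σ,
    Finset.sum_eq_single ((Finset.univ.filter fun x => σ x = 1).card)]
  · ring
  · intro k _ hk
    rw [gibbs_ind_apply_eq_zero G Δ ht (Ne.symm hk), zero_mul]
  · intro h
    exact absurd (Finset.mem_range.mpr (Nat.lt_succ_of_le
      ((Finset.card_filter_le _ _).trans (Finset.card_univ (α := V)).le))) h

/-- Sums over configurations are sums over occupation indicators `1⁰_S`. [folklore] -/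
theorem sum_config_eq_sum_indicator (F : (V → Fin 2) → ℂ) :
    (∑ σ : V → Fin 2, F σ) = ∑ S : Finset V, F (fun i => if i ∈ S then 0 else 1) := by
  let e : Finset V ≃ (V → Fin 2) :=
    { toFun := fun S i => if i ∈ S then 0 else 1
      invFun := fun σ => Finset.univ.filter fun x => σ x = 0
      left_inv := fun S => ((coneSel_indicator_eq_iff S _).1 rfl).symm
      right_inv := fun σ => coneSel_indicator_filter_eq σ }
  exact (Fintype.sum_equiv e _ _ fun S => rfl).symm

/-- The occupation indicator `1⁰_S` (value `0` on `S`, `1` off `S`) has `|Sᶜ|` sites with value `1`.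
[folklore] -/
theorem filter_indicator_eq_one_eq_compl (S : Finset V) :
    (Finset.univ.filter fun i => (if i ∈ S then (0 : Fin 2) else 1) = 1) = Sᶜ := by
  ext i
  simp only [Finset.mem_filter, Finset.mem_univ, true_and, Finset.mem_compl]
  by_cases hi : i ∈ S <;> simp [hi]

/-- **The occupation polynomial of the product state `Φ_y` is `Π_x (z_x + y)`.** [folklore] -/
theorem occ_productState (y : ℂ) (z : V → ℂ) :
    (∑ S : Finset V, (fun τ : V → Fin 2 => y ^ (Finset.univ.filter fun x => τ x = 1).card)
        (fun i => if i ∈ S then 0 else 1) * ∏ i ∈ S, z i) = ∏ i, (z i + y) := by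
  rw [Finset.prod_add, Finset.powerset_univ]
  refine Finset.sum_congr rfl fun S _ => ?_
  simp only [filter_indicator_eq_one_eq_compl]
  rw [← Finset.compl_eq_univ_sdiff, Finset.prod_const, mul_comm]

/-- The occupation polynomial of `Φ_y` has no zero in `ℍ^V` when `Im y ≥ 0`. [folklore] -/
theorem occ_productState_ne_zero {y : ℂ} (hy : 0 ≤ y.im) {z : V → ℂ} (hz : ∀ i, 0 < (z i).im) :
    (∑ S : Finset V, (fun τ : V → Fin 2 => y ^ (Finset.univ.filter fun x => τ x = 1).card)
        (fun i => if i ∈ S then 0 else 1) * ∏ i ∈ S, z i) ≠ 0 := by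
  rw [occ_productState]
  refine Finset.prod_ne_zero_iff.mpr fun i _ h => ?_
  have him : (z i + y).im = 0 := by rw [h, Complex.zero_im]
  rw [Complex.add_im] at him
  linarith [hz i]

end Helpers

/-- **`XXZSectorHeatAmplitudeLogConcave` HOLDS** (memo ROTOR-THEORY-6 §67, finite-`t` form): for every
finite graph, `Δ ∈ [−1, 1]`, `t ≥ 0` and `1 ≤ W ≤ |V| − 1`, the heat amplitudes
`c_k = Re⟨𝟙_k, e^{−tH} 𝟙_k⟩` satisfy `c_{W−1} c_{W+1} ≤ c_W c_W`. [folklore] -/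
theorem xxzSectorHeatAmplitudeLogConcave_holds : XXZSectorHeatAmplitudeLogConcave := by
  intro V _ _ G _ Δ h1 h2 t ht W hW1 hWc
  dsimp only
  set n := Fintype.card V with hn
  -- the heat coefficients (real numbers) and their complex versions
  set c : ℕ → ℝ := fun k =>
    (star (fun τ : V → Fin 2 => if (Finset.univ.filter fun x => τ x = 1).card = k then (1 : ℂ) else 0) ⬝ᵥ
      NormedSpace.exp (-(t : ℂ) • xxzHamiltonian 1 G (-1) Δ) *ᵥ
        (fun τ : V → Fin 2 => if (Finset.univ.filter fun x => τ x = 1).card = k then (1 : ℂ) else 0)).re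
    with hc
  show c (W - 1) * c (W + 1) ≤ c W * c W
  have hΔ : |Δ| ≤ 1 := abs_le.mpr ⟨h1, h2⟩
  have hC : ∀ k,
      star (fun τ : V → Fin 2 => if (Finset.univ.filter fun x => τ x = 1).card = k then (1 : ℂ) else 0) ⬝ᵥ
        NormedSpace.exp (-(t : ℂ) • xxzHamiltonian 1 G (-1) Δ) *ᵥ
          (fun τ : V → Fin 2 => if (Finset.univ.filter fun x => τ x = 1).card = k then (1 : ℂ) else 0) =
        ((c k : ℝ) : ℂ) :=
    fun k => heatCoeff_eq_ofReal G Δ ht k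
  -- `c 0 > 0`
  have hc0 : 0 < c 0 :=
    (heatRate_sector_allGraphs G Δ 0 ⟨fun _ => 0, by simp⟩).1 t ht
  -- the coefficients `A_S = (e^{−tH} 𝟙_{n − |S|})(1⁰_S)` and the evolved product state
  set A : Finset V → ℂ := fun S =>
    (NormedSpace.exp (-(t : ℂ) • xxzHamiltonian 1 G (-1) Δ) *ᵥ
      (fun τ : V → Fin 2 => if (Finset.univ.filter fun x => τ x = 1).card = n - S.card
        then (1 : ℂ) else 0)) (fun i => if i ∈ S then 0 else 1) with hA
  have hTΦ : ∀ (y : ℂ) (S : Finset V),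
      (NormedSpace.exp (-(t : ℂ) • xxzHamiltonian 1 G (-1) Δ) *ᵥ
        (fun τ : V → Fin 2 => y ^ (Finset.univ.filter fun x => τ x = 1).card))
          (fun i => if i ∈ S then 0 else 1) = y ^ (n - S.card) * A S := by
    intro y S
    rw [gibbs_productState_apply G Δ ht y, filter_indicator_eq_one_eq_compl, Finset.card_compl]
  -- the regrouped generating function
  have hregroup : ∀ y : ℂ, (∑ S : Finset V, A S * y ^ (n - S.card)) =
      ∑ k ∈ Finset.range (n + 1), ((c k : ℝ) : ℂ) * y ^ k := by
    intro y
    have h1 : (∑ S : Finset V, A S * y ^ (n - S.card)) =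
        ∑ σ : V → Fin 2, (NormedSpace.exp (-(t : ℂ) • xxzHamiltonian 1 G (-1) Δ) *ᵥ
          (fun τ : V → Fin 2 => y ^ (Finset.univ.filter fun x => τ x = 1).card)) σ := by
      rw [sum_config_eq_sum_indicator]
      exact Finset.sum_congr rfl fun S _ => by rw [hTΦ y S, mul_comm]
    rw [h1, sum_gibbs_productState G Δ ht y]
    exact Finset.sum_congr rfl fun k _ => by rw [hC k]
  -- the stable polynomial `Q(y, z)` in `1 + |V|` variables
  set Q : MvPolynomial (Unit ⊕ V) ℂ := ∑ S : Finset V,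
    MvPolynomial.C (A S) * MvPolynomial.X (Sum.inl ()) ^ (n - S.card) *
      ∏ i ∈ S, (MvPolynomial.X (Sum.inr i) + 1) with hQ
  have hQeval : ∀ w : Unit ⊕ V → ℂ, MvPolynomial.eval w Q =
      ∑ S : Finset V, A S * w (Sum.inl ()) ^ (n - S.card) * ∏ i ∈ S, (w (Sum.inr i) + 1) := by
    intro w
    simp only [hQ, map_sum, map_mul, map_prod, map_pow, map_add, map_one, MvPolynomial.eval_C,
      MvPolynomial.eval_X]
  have hQst : IsUpperHalfPlaneStable Q := by
    intro w hw
    rw [hQeval]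
    have hz : ∀ i, 0 < (w (Sum.inr i) + 1).im := fun i => by
      rw [Complex.add_im, Complex.one_im, add_zero]; exact hw _
    have hocc := xxz_gibbs_preserves_occStable G hΔ ht
      (fun τ : V → Fin 2 => w (Sum.inl ()) ^ (Finset.univ.filter fun x => τ x = 1).card)
      (fun z hz' => occ_productState_ne_zero (hw _).le hz') (fun i => w (Sum.inr i) + 1) hz
    have heq : (∑ S : Finset V, A S * w (Sum.inl ()) ^ (n - S.card) * ∏ i ∈ S, (w (Sum.inr i) + 1)) =
        ∑ S : Finset V, (NormedSpace.exp (-(t : ℂ) • xxzHamiltonian 1 G (-1) Δ) *ᵥ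
          (fun τ : V → Fin 2 => w (Sum.inl ()) ^ (Finset.univ.filter fun x => τ x = 1).card))
            (fun i => if i ∈ S then 0 else 1) * ∏ i ∈ S, (w (Sum.inr i) + 1) :=
      Finset.sum_congr rfl fun S _ => by rw [hTΦ, mul_comm (A S)]
    rw [heq]
    exact hocc
  -- specialise the `z`-block at `0`: `q(y) = Σ_k c_k y^k` is zero-free on `ℍ`
  have hq_eval : ∀ y : ℂ, MvPolynomial.eval (fun _ => y) (setInrZero Q) =
      ∑ k ∈ Finset.range (n + 1), ((c k : ℝ) : ℂ) * y ^ k := by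
    intro y
    rw [eval_setInrZero, hQeval, ← hregroup y]
    refine Finset.sum_congr rfl fun S _ => ?_
    simp only [Sum.elim_inl, Sum.elim_inr, zero_add, Finset.prod_const_one, mul_one]
  have hq_ne : ∀ y : ℂ, 0 < y.im → (∑ k ∈ Finset.range (n + 1), ((c k : ℝ) : ℂ) * y ^ k) ≠ 0 := by
    intro y hy
    rcases hQst.eq_zero_or_setInrZero with hzero | hst
    · -- impossible: the constant coefficient is `c 0 > 0`
      exfalso
      have h0 := hq_eval 0
      rw [hzero, map_zero] at h0
      have h00 : (∑ k ∈ Finset.range (n + 1), ((c k : ℝ) : ℂ) * (0 : ℂ) ^ k) = ((c 0 : ℝ) : ℂ) := by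
        rw [Finset.sum_eq_single 0]
        · simp
        · intro k _ hk; rw [zero_pow hk, mul_zero]
        · intro h; exact absurd (Finset.mem_range.mpr (Nat.succ_pos n)) h
      rw [h00] at h0
      exact hc0.ne' (by exact_mod_cast h0.symm)
    · rw [← hq_eval y]
      exact hst (fun _ => y) (fun _ => hy)
  -- the real polynomial `f = Σ_k c_k X^k` is real-rooted
  set f : Polynomial ℝ := ∑ k ∈ Finset.range (n + 1), Polynomial.monomial k (c k) with hf
  have hcoeff : ∀ j, j ≤ n → f.coeff j = c j := by
    intro j hj
    rw [hf, Polynomial.finsetSum_coeff]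
    simp only [Polynomial.coeff_monomial]
    rw [Finset.sum_ite_eq', if_pos (Finset.mem_range.mpr (Nat.lt_succ_of_le hj))]
  have haeval : ∀ y : ℂ, Polynomial.aeval y f = ∑ k ∈ Finset.range (n + 1), ((c k : ℝ) : ℂ) * y ^ k := by
    intro y
    rw [hf, map_sum]
    refine Finset.sum_congr rfl fun k _ => ?_
    rw [Polynomial.aeval_monomial, Complex.coe_algebraMap]
  have hconj : ∀ y : ℂ, (∑ k ∈ Finset.range (n + 1), ((c k : ℝ) : ℂ) * (conj y) ^ k) =
      conj (∑ k ∈ Finset.range (n + 1), ((c k : ℝ) : ℂ) * y ^ k) := by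
    intro y
    rw [map_sum]
    refine Finset.sum_congr rfl fun k _ => ?_
    rw [map_mul, map_pow, Complex.conj_ofReal]
  have hroots : ∀ z ∈ f.aroots ℂ, z.im = 0 := by
    intro z hz
    have hz0 : (∑ k ∈ Finset.range (n + 1), ((c k : ℝ) : ℂ) * z ^ k) = 0 := by
      rw [← haeval]; exact (Polynomial.mem_aroots'.mp hz).2
    rcases lt_trichotomy z.im 0 with hlt | heq | hgt
    · exfalso
      refine hq_ne (conj z) (by rw [Complex.conj_im]; linarith) ?_
      rw [hconj, hz0, map_zero]
    · exact heq
    · exact absurd hz0 (hq_ne z hgt)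
  have hsplit : f.Splits := Literature.Algebra.Polynomial.splits_of_forall_mem_aroots_im_eq_zero hroots
  -- Newton's inequality for the real-rooted `f`
  have key := Literature.Algebra.Polynomial.NewtonInequalities.coeff_mul_coeff_le_sq hsplit hW1
  rw [hcoeff (W - 1) (by omega), hcoeff (W + 1) hWc, hcoeff W (by omega), pow_two] at key
  exact key

/-- **THEOREM E-CONV HOLDS (unconditional; memo ROTOR-THEORY-6 §67):** on every finite graph and for
every `Δ ∈ [−1, 1]`, the lowest energies `E(M)` of `xxzHamiltonian 1 G (−1) Δ` in the magnetisation
sectors are midpoint-convex along the ladder: `2E(M) ≤ E(M−1) + E(M+1)` whenever the three sectors are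
non-trivial.  `xxzSectorEnergyConvex_of_logConcave xxzSectorHeatAmplitudeLogConcave_holds`. [folklore] -/
theorem xxzSectorEnergyConvex_holds : XXZSectorEnergyConvex :=
  xxzSectorEnergyConvex_of_logConcave xxzSectorHeatAmplitudeLogConcave_holds

end Summit.HubbardSuperconductivity.HubbardSuperconductivity.Theorems.AnisotropyChord
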